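import Summits.FinalStateConjecture.FinalStateConjecture.Theorems.ClusterCompletenessAdiabaticMultiKerrILEDZoneDisjoint
import Summits.FinalStateConjecture.FinalStateConjecture.Theorems.ClusterCompletenessAdiabaticMultiKerrILEDField
import HarnessLib

/-!
# Route ClusterCompleteness — crux `AdiabaticMultiKerrILED`, line `Sketch`: the rest-frame
# pull-back of a crux solution solves the exact Kerr wave equation in its zone

Helper file for the crux `stmt-FinalStateConjecture-14310`
(`Summit.FinalStateConjecture.FinalStateConjecture.Theses.ClusterCompleteness.AdiabaticMultiKerrILED`),
closing the stub `stub_zonePullbackWave` of line `Sketch` (classical stub W2 of the late-time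
red-shift assembly).

The patched inverse metric of the crux is `G = η − Σⱼ χⱼ · 2Hⱼ(qⱼ ·) · (Λⱼℓ♯ⱼ(qⱼ ·)) ⊗ (Λⱼℓ♯ⱼ(qⱼ ·))`
with `qⱼ = poincareInv Λⱼ (0, pⱼ)` the affine map to the rest frame of hole `j` and
`χⱼ = smoothTransition (2 − rⱼ/8Mⱼ)` (`= 1` on `{rⱼ ≤ 8Mⱼ}`, `= 0` on `{16Mⱼ ≤ rⱼ}`). If `ψ` solves the
divergence-form equation `Σ_μ ∂_μ (Σ_ν G^{μν} ∂_ν ψ) = 0` at the lab points with `x⁰ ≥ 0` outside all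
horizons, then `Φᵢ = ψ ∘ Pᵢ`, `Pᵢ w = Λᵢ w + (0, pᵢ)` (so `qᵢ ∘ Pᵢ = id`), solves the EXACT Kerr
equation `□_{g_{Mᵢ,aᵢ}} Φᵢ = 0` (`KerrSchild.waveOperator` of `η − 2Hᵢ ℓ♯ᵢ ⊗ ℓ♯ᵢ`) at every rest-frame
point `z` with `r₊ < rᵢ(z) < 8Mᵢ` whose lab image `x = Pᵢ z` has `x⁰ ≥ 0`.

Proof.
* (a) At `x = Pᵢ z`: `qᵢ x = z`, so `rᵢ ≤ 17Mᵢ` and zone disjointness (`stub_zoneDisjoint`) gives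
  `rⱼ(qⱼ x) > 17Mⱼ > 2Mⱼ ≥ r₊ⱼ` for `j ≠ i`; hence `x` is outside all horizons and `□_G ψ (x) = 0`.
  The conditions `rᵢ < 8Mᵢ`, `rⱼ > 16Mⱼ` are open (`Kerr.continuous_radius`, `continuous_poincareInv`),
  so near `x` the patched field IS the (untruncated) boosted field
  `Gᵢ = η − 2Hᵢ(qᵢ ·) (Λᵢℓ♯ᵢ(qᵢ ·)) ⊗ (Λᵢℓ♯ᵢ(qᵢ ·))` of hole `i`, and by locality of the divergence-form
  operator (`KerrSchild.waveOperator_congr_of_eventuallyEq`) `□_{Gᵢ} ψ (x) = 0`.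
* (b) Covariance of the divergence-form operator under the affine map `P w = Λ w + c`
  (`waveOperator_comp_affine`): with `B = Λ⁻¹` and the pulled-back coefficients
  `K'(w)^{μν} = Σ_{αβ} B^μ_α B^ν_β K(Pw)^{αβ}`, `□_{K'} (u ∘ P) (z) = □_K u (Pz)` — twice the chain rule
  `d(f ∘ P)(w) = df(Pw) ∘ Λ` (no differentiability needed) and `Λ ∘ Λ⁻¹ = id` in coordinates; the
  second application differentiates `Σ_α B^μ_α V_α` termwise, which is where smoothness of `ψ` and
  of `Gᵢ` at the exterior point `x` (`r > r₊ > 0`; `Kerr.contDiffAt_scalarH_comp`,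
  `Kerr.contDiffAt_nullVector_comp`) enters.
* (c) For `K = Gᵢ` the pulled-back field is the exact Kerr field: `Σ B^μ_α B^ν_β η^{αβ} = η^{μν}`
  because `Λ⁻¹ = η Λᵀ η` for `Λ ∈ O(1,3)` (`lorentz_symm_basisVector_apply`), and
  `Σ_α B^μ_α (Λℓ)^α = ℓ^μ`.
O'Neill 1983, Ch. 9, pp. 233–236 (Lorentz and Poincaré maps); Kerr–Schild 1965, §2 (Lorentz
covariance of the Kerr–Schild ansatz); Dafermos–Rodnianski arXiv:0811.0354, §3.3 (the red-shift
estimate is applied to exact Kerr). [folklore]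
-/

noncomputable section

-- the doubled `FinalStateConjecture.FinalStateConjecture` path component trips dupNamespace
set_option linter.dupNamespace false

open scoped ContDiff Topology BigOperators InnerProductSpace
open Filter Set Literature.Geometry.Lorentzian

namespace Summit.FinalStateConjecture.FinalStateConjecture.Cruxes.AdiabaticMultiKerrILED.Sketch

/-! ### Coordinate algebra on `E4` -/

/-- Expansion of a linear functional in the coordinate frame: `Σ_ν v^ν L(∂_ν) = L(v)`
(`v = Σ_ν v^ν ∂_ν`). [folklore] -/
private theorem sum_mul_map_basisVector (L : E4 →L[ℝ] ℝ) (v : E4) :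
    ∑ ν, v ν * L (E4.basisVector ν) = L v := by
  conv_rhs => rw [Kerr.eq_sum_basisVector v, map_sum]
  exact Finset.sum_congr rfl fun ν _ ↦ by rw [map_smul, smul_eq_mul]

/-- `Λ⁻¹ ∘ Λ = id` in coordinates: `Σ_α (Λ⁻¹ ∂_α)^μ (Λ v)^α = v^μ`. [folklore] -/
private theorem sum_symm_basisVector_mul (A : E4 ≃L[ℝ] E4) (v : E4) (μ : Fin 4) :
    ∑ α, (A.symm (E4.basisVector α)) μ * (A v) α = v μ := by
  have h := sum_mul_map_basisVector
    ((EuclideanSpace.proj (𝕜 := ℝ) μ).comp (A.symm : E4 →L[ℝ] E4)) (A v)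
  simp only [ContinuousLinearMap.comp_apply, ContinuousLinearEquiv.coe_coe,
    ContinuousLinearEquiv.symm_apply_apply, PiLp.proj_apply] at h
  rw [← h]
  exact Finset.sum_congr rfl fun α _ ↦ mul_comm _ _

/-- `η_{αα}² = 1`. [folklore] -/
private theorem etaComp_diag_mul_self (α : Fin 4) : Kerr.etaComp α α * Kerr.etaComp α α = 1 := by
  rw [Kerr.etaComp, if_pos rfl]
  split_ifs <;> norm_num

/-- `η(∂_α, y) = η_{αα} y^α` (O'Neill 1983, Ch. 3, p. 55). [folklore] -/
private theorem minkowski_basisVector_left (α : Fin 4) (y : E4) :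
    Minkowski.bilin (E4.basisVector α) y = Kerr.etaComp α α * y α := by
  fin_cases α <;> simp [Kerr.etaComp, E4.basisVector, Fin.sum_univ_three, Minkowski.bilin_apply]

/-- `η(y, ∂_ν) = η_{νν} y^ν` (O'Neill 1983, Ch. 3, p. 55). [folklore] -/
private theorem minkowski_basisVector_right (y : E4) (ν : Fin 4) :
    Minkowski.bilin y (E4.basisVector ν) = Kerr.etaComp ν ν * y ν := by
  rw [Minkowski.bilin_symm, minkowski_basisVector_left]

/-- **`Λ⁻¹ = η Λᵀ η` for `Λ ∈ O(1,3)`**, in coordinates: `(Λ⁻¹ ∂_α)^ν = η_{νν} η_{αα} (Λ ∂_ν)^α`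
(pair `η(Λ Λ⁻¹ ∂_α, Λ ∂_ν) = η(Λ⁻¹ ∂_α, ∂_ν)`; O'Neill 1983, Ch. 9, p. 233). [folklore] -/
private theorem lorentz_symm_basisVector_apply (Λ : lorentzGroup) (α ν : Fin 4) :
    ((Λ : E4 ≃L[ℝ] E4).symm (E4.basisVector α)) ν =
      Kerr.etaComp ν ν * Kerr.etaComp α α * ((Λ : E4 ≃L[ℝ] E4) (E4.basisVector ν)) α := by
  have h := Λ.2 ((Λ : E4 ≃L[ℝ] E4).symm (E4.basisVector α)) (E4.basisVector ν)
  rw [ContinuousLinearEquiv.apply_symm_apply, minkowski_basisVector_left,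
    minkowski_basisVector_right] at h
  have hν := etaComp_diag_mul_self ν
  calc ((Λ : E4 ≃L[ℝ] E4).symm (E4.basisVector α)) ν
      = Kerr.etaComp ν ν *
          (Kerr.etaComp ν ν * ((Λ : E4 ≃L[ℝ] E4).symm (E4.basisVector α)) ν) := by
        rw [← mul_assoc, hν, one_mul]
    _ = _ := by rw [← h]; ring

/-- **`Λ⁻¹ η⁻¹ Λ⁻ᵀ = η⁻¹` for `Λ ∈ O(1,3)`**: `Σ_{αβ} (Λ⁻¹∂_α)^μ (Λ⁻¹∂_β)^ν η(∂_α, ∂_β) = η^{μν}`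
(O'Neill 1983, Ch. 9, p. 233). [folklore] -/
private theorem sum_sum_lorentz_symm_eta (Λ : lorentzGroup) (μ ν : Fin 4) :
    ∑ α, ∑ β, ((Λ : E4 ≃L[ℝ] E4).symm (E4.basisVector α)) μ *
      ((Λ : E4 ≃L[ℝ] E4).symm (E4.basisVector β)) ν *
      Minkowski.bilin (E4.basisVector α) (E4.basisVector β) = Kerr.etaComp μ ν := by
  have hdiag : ∀ α, ∑ β, ((Λ : E4 ≃L[ℝ] E4).symm (E4.basisVector α)) μ *
      ((Λ : E4 ≃L[ℝ] E4).symm (E4.basisVector β)) ν *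
      Minkowski.bilin (E4.basisVector α) (E4.basisVector β) =
      Kerr.etaComp ν ν * (((Λ : E4 ≃L[ℝ] E4).symm (E4.basisVector α)) μ *
        ((Λ : E4 ≃L[ℝ] E4) (E4.basisVector ν)) α) := by
    intro α
    rw [Finset.sum_eq_single α (fun β _ hβα ↦ ?_) fun h ↦ absurd (Finset.mem_univ α) h]
    · rw [Kerr.minkowski_bilin_basisVector, lorentz_symm_basisVector_apply Λ α ν]
      have hα := etaComp_diag_mul_self α
      linear_combination (Kerr.etaComp ν ν * ((Λ : E4 ≃L[ℝ] E4).symm (E4.basisVector α)) μ *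
        ((Λ : E4 ≃L[ℝ] E4) (E4.basisVector ν)) α) * hα
    · rw [Kerr.minkowski_bilin_basisVector]
      simp [Kerr.etaComp, Ne.symm hβα]
  rw [Finset.sum_congr rfl fun α _ ↦ hdiag α, ← Finset.mul_sum, sum_symm_basisVector_mul]
  by_cases h : μ = ν
  · subst h
    simp [E4.basisVector]
  · simp [E4.basisVector, Kerr.etaComp, h]

/-- **The boosted Kerr–Schild coefficients pull back to the rest-frame ones**:
`Σ_{αβ} (Λ⁻¹∂_α)^μ (Λ⁻¹∂_β)^ν (η^{αβ} − φ (Λl)^α (Λl)^β) = η^{μν} − φ l^μ l^ν` for `Λ ∈ O(1,3)`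
(Lorentz covariance of the Kerr–Schild ansatz; Kerr–Schild 1965, §2). [folklore] -/
private theorem pullback_boostedKerrSchild (Λ : lorentzGroup) (φ : ℝ) (l : E4) (μ ν : Fin 4) :
    ∑ α, ∑ β, ((Λ : E4 ≃L[ℝ] E4).symm (E4.basisVector α)) μ *
      ((Λ : E4 ≃L[ℝ] E4).symm (E4.basisVector β)) ν *
      (Minkowski.bilin (E4.basisVector α) (E4.basisVector β) -
        φ * ((Λ : E4 ≃L[ℝ] E4) l) α * ((Λ : E4 ≃L[ℝ] E4) l) β) =
      Kerr.etaComp μ ν - φ * l μ * l ν := by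
  simp only [mul_sub, Finset.sum_sub_distrib]
  rw [sum_sum_lorentz_symm_eta]
  congr 1
  rw [← sum_symm_basisVector_mul (Λ : E4 ≃L[ℝ] E4) l μ,
    ← sum_symm_basisVector_mul (Λ : E4 ≃L[ℝ] E4) l ν, mul_assoc, Finset.sum_mul_sum,
    Finset.mul_sum]
  refine Finset.sum_congr rfl fun α _ ↦ ?_
  rw [Finset.mul_sum]
  refine Finset.sum_congr rfl fun β _ ↦ ?_
  ring

/-! ### Covariance of the divergence-form wave operator under affine maps -/

/-- Chain rule under the affine map `P v = A v + c`: `d(f ∘ P)(w) = df(Pw) ∘ A`, without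
differentiability hypothesis (both sides vanish when `f` is not differentiable at `Pw`). [folklore] -/
private theorem fderiv_comp_affine (A : E4 ≃L[ℝ] E4) (c : E4) (f : E4 → ℝ) (w : E4) :
    fderiv ℝ (fun v ↦ f (A v + c)) w = (fderiv ℝ f (A w + c)).comp (A : E4 →L[ℝ] E4) := by
  have h : (fun v ↦ f (A v + c)) = (fun y ↦ f (y + c)) ∘ A := rfl
  rw [h, A.comp_right_fderiv, fderiv_comp_add_right]

/-- **Covariance of the divergence-form wave operator under affine reparametrisation.** For an
invertible linear `A`, a translation `c`, `P w = A w + c`, `B = A⁻¹`, a coefficient field `K` and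
a function `u`, the pulled-back coefficients `K'(w)^{μν} = Σ_{αβ} (B∂_α)^μ (B∂_β)^ν K(Pw)^{αβ}`
satisfy `□_{K'} (u ∘ P) (z) = □_K u (Pz)`, provided the fluxes `V_α = Σ_β K^{αβ} ∂_β u` are
differentiable at `Pz` (tensoriality of `∂_μ(K^{μν} ∂_ν u)` under affine maps; O'Neill 1983, Ch. 3,
p. 58 and Ch. 9, p. 236). [folklore] -/
private theorem waveOperator_comp_affine (A : E4 ≃L[ℝ] E4) (c : E4)
    (K : E4 → Fin 4 → Fin 4 → ℝ) (u : E4 → ℝ) (z : E4)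
    (hV : ∀ α, DifferentiableAt ℝ
      (fun y ↦ ∑ β, K y α β * fderiv ℝ u y (E4.basisVector β)) (A z + c)) :
    KerrSchild.waveOperator (fun w μ ν ↦ ∑ α, ∑ β, (A.symm (E4.basisVector α)) μ *
        (A.symm (E4.basisVector β)) ν * K (A w + c) α β) (fun w ↦ u (A w + c)) z =
      KerrSchild.waveOperator K u (A z + c) := by
  -- the fluxes `V_α = Σ_β K^{αβ} ∂_β u`
  obtain ⟨V, hVdef⟩ : ∃ V : Fin 4 → E4 → ℝ,
      ∀ α y, V α y = ∑ β, K y α β * fderiv ℝ u y (E4.basisVector β) := ⟨_, fun _ _ ↦ rfl⟩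
  have hVd : ∀ α, DifferentiableAt ℝ (V α) (A z + c) := fun α ↦ by
    rw [show V α = _ from funext (hVdef α)]
    exact hV α
  -- (1) the pulled-back fluxes: `Σ_ν K'^{μν} ∂_ν(u ∘ P) = (Σ_α (B∂_α)^μ V_α) ∘ P`
  have h1 : ∀ μ, (fun w ↦ ∑ ν, (∑ α, ∑ β, (A.symm (E4.basisVector α)) μ *
      (A.symm (E4.basisVector β)) ν * K (A w + c) α β) *
      fderiv ℝ (fun v ↦ u (A v + c)) w (E4.basisVector ν)) =
      fun w ↦ ∑ α, (A.symm (E4.basisVector α)) μ * V α (A w + c) := by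
    intro μ
    funext w
    rw [fderiv_comp_affine]
    simp only [ContinuousLinearMap.comp_apply, ContinuousLinearEquiv.coe_coe, hVdef]
    have key : ∀ β, fderiv ℝ u (A w + c) (E4.basisVector β) =
        ∑ ν, (A.symm (E4.basisVector β)) ν * fderiv ℝ u (A w + c) (A (E4.basisVector ν)) := by
      intro β
      have h := sum_mul_map_basisVector ((fderiv ℝ u (A w + c)).comp (A : E4 →L[ℝ] E4))
        (A.symm (E4.basisVector β))
      simp only [ContinuousLinearMap.comp_apply, ContinuousLinearEquiv.coe_coe,
        ContinuousLinearEquiv.apply_symm_apply] at h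
      exact h.symm
    simp only [key, Finset.mul_sum, Finset.sum_mul]
    rw [Finset.sum_comm]
    refine Finset.sum_congr rfl fun α _ ↦ ?_
    rw [Finset.sum_comm]
    refine Finset.sum_congr rfl fun β _ ↦ Finset.sum_congr rfl fun ν _ ↦ ?_
    ring
  -- (2) the outer derivative: `∂_μ ((Σ_α (B∂_α)^μ V_α) ∘ P)(z) = Σ_α (B∂_α)^μ dV_α(Pz)(A∂_μ)`
  have h2 : ∀ μ, fderiv ℝ (fun w ↦ ∑ α, (A.symm (E4.basisVector α)) μ * V α (A w + c)) z
      (E4.basisVector μ) =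
      ∑ α, (A.symm (E4.basisVector α)) μ * fderiv ℝ (V α) (A z + c) (A (E4.basisVector μ)) := by
    intro μ
    have h := fderiv_comp_affine A c (fun y ↦ ∑ α, (A.symm (E4.basisVector α)) μ * V α y) z
    beta_reduce at h
    rw [h, ContinuousLinearMap.comp_apply, ContinuousLinearEquiv.coe_coe,
      fderiv_fun_sum fun α _ ↦ (hVd α).const_mul _, _root_.sum_apply]
    refine Finset.sum_congr rfl fun α _ ↦ ?_
    rw [fderiv_const_mul (hVd α), _root_.smul_apply, smul_eq_mul]
  -- (3) assemble: `Σ_μ (A∂_μ)^κ (B∂_α)^μ = δ^κ_α`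
  rw [KerrSchild.waveOperator_apply, KerrSchild.waveOperator_apply]
  calc ∑ μ, fderiv ℝ (fun w ↦ ∑ ν, (∑ α, ∑ β, (A.symm (E4.basisVector α)) μ *
          (A.symm (E4.basisVector β)) ν * K (A w + c) α β) *
          fderiv ℝ (fun v ↦ u (A v + c)) w (E4.basisVector ν)) z (E4.basisVector μ)
      = ∑ μ, ∑ α, (A.symm (E4.basisVector α)) μ *
          fderiv ℝ (V α) (A z + c) (A (E4.basisVector μ)) := by
        refine Finset.sum_congr rfl fun μ _ ↦ ?_
        rw [h1 μ, h2 μ]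
    _ = ∑ α, ∑ μ, (A.symm (E4.basisVector α)) μ *
          fderiv ℝ (V α) (A z + c) (A (E4.basisVector μ)) := Finset.sum_comm
    _ = ∑ α, fderiv ℝ (V α) (A z + c) (E4.basisVector α) := by
        refine Finset.sum_congr rfl fun α _ ↦ ?_
        have h := sum_mul_map_basisVector ((fderiv ℝ (V α) (A z + c)).comp (A : E4 →L[ℝ] E4))
          (A.symm (E4.basisVector α))
        simp only [ContinuousLinearMap.comp_apply, ContinuousLinearEquiv.coe_coe,
          ContinuousLinearEquiv.apply_symm_apply] at h
        exact h
    _ = _ := by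
        refine Finset.sum_congr rfl fun α _ ↦ ?_
        rw [show V α = _ from funext (hVdef α)]

/-! ### Smoothness of the own field of a hole at exterior points -/

/-- The untruncated boosted field `y ↦ η(∂_μ, ∂_ν) − 2H(qy) (Λℓ♯(qy))^μ (Λℓ♯(qy))^ν` of one hole is
`C^∞` at every point whose rest-frame radius is positive (`q = poincareInv Λ c` affine; `H`, `ℓ♯`
real-analytic off the ring). [folklore] -/
private theorem contDiffAt_ownField (Mi ai : ℝ) (Λi : lorentzGroup) (c : E4) {x : E4}
    (hx : 0 < Kerr.radius ai (poincareInv Λi c x)) (μ ν : Fin 4) :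
    ContDiffAt ℝ ∞ (fun y ↦ Minkowski.bilin (E4.basisVector μ) (E4.basisVector ν) -
      2 * Kerr.scalarH Mi ai (poincareInv Λi c y) *
        ((Λi : E4 ≃L[ℝ] E4) (Kerr.nullVector ai (poincareInv Λi c y))) μ *
        ((Λi : E4 ≃L[ℝ] E4) (Kerr.nullVector ai (poincareInv Λi c y))) ν) x := by
  have hq : ContDiffAt ℝ ∞ (poincareInv Λi c) x := (contDiff_poincareInv Λi c).contDiffAt
  have hH : ContDiffAt ℝ ∞ (fun y ↦ Kerr.scalarH Mi ai (poincareInv Λi c y)) x :=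
    Kerr.contDiffAt_scalarH_comp contDiffAt_const contDiffAt_const hq hx
  have hl : ContDiffAt ℝ ∞ (fun y ↦ Kerr.nullVector ai (poincareInv Λi c y)) x :=
    Kerr.contDiffAt_nullVector_comp contDiffAt_const hq hx
  have hΛl : ContDiffAt ℝ ∞
      (fun y ↦ (Λi : E4 ≃L[ℝ] E4) (Kerr.nullVector ai (poincareInv Λi c y))) x :=
    ((Λi : E4 ≃L[ℝ] E4) : E4 →L[ℝ] E4).contDiff.contDiffAt.comp x hl
  have hcomp : ∀ κ : Fin 4, ContDiffAt ℝ ∞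
      (fun y ↦ ((Λi : E4 ≃L[ℝ] E4) (Kerr.nullVector ai (poincareInv Λi c y))) κ) x :=
    contDiffAt_euclidean.mp hΛl
  exact contDiffAt_const.sub (((contDiffAt_const.mul hH).mul (hcomp μ)).mul (hcomp ν))

/-! ### The stub -/

/-- **The rest-frame pull-back of a crux solution solves the exact Kerr wave equation in zone `i`**
(classical stub W2 of line `Sketch`): under the crux hypotheses (thresholds `α, v₀ ≤ 1/2`,
`d₀ ≥ 40`), if `ψ` solves `□_G ψ = 0` at the lab points with `x⁰ ≥ 0` outside all horizons, then
`Φᵢ = ψ ∘ Pᵢ`, `Pᵢ z = Λᵢ z + (0, pᵢ)` (so `qᵢ ∘ Pᵢ = id`), satisfies `□_{g_{Mᵢ,aᵢ}} Φᵢ = 0`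
(divergence form, `KerrSchild.waveOperator` of `η − 2H ℓ♯ ⊗ ℓ♯`) at every rest-frame point `z` with
`r₊ < r(z) < 8Mᵢ` whose lab image has `x⁰ ≥ 0`. Proof: near `Pᵢ z` the patched field IS the
boosted Kerr field of hole `i` (`χᵢ = 1` for `rᵢ < 8Mᵢ`, the other terms vanish by
`stub_zoneDisjoint` and openness, as in `stub_zoneKilling`), so `□_{Gᵢ} ψ (Pᵢ z) = 0` by locality;
covariance of the divergence-form operator under the affine map `Pᵢ` (`waveOperator_comp_affine`:
chain rule twice, `Λ Λ⁻¹ = id`); and `Λ⁻¹ η⁻¹ Λ⁻ᵀ = η⁻¹`, `Λ⁻¹(Λℓ♯) = ℓ♯` identify the pulled-back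
coefficients with `η − 2Hᵢ ℓ♯ᵢ ⊗ ℓ♯ᵢ`. O'Neill 1983, Ch. 9, pp. 233–236; Kerr–Schild 1965, §2.
[folklore] -/
theorem stub_zonePullbackWave :
    ∀ {N : ℕ} (M a : Fin N → ℝ) (Λ : Fin N → lorentzGroup) (p : Fin N → E3) (u : Fin N → E4)
      (q : Fin N → E4 → E4),
      (∀ i, u i = (Λ i : E4 ≃L[ℝ] E4) (E4.basisVector 0)) →
      (∀ i x, q i x = poincareInv (Λ i) (E4.ofTimeSpace 0 (p i)) x) →
      (∀ i, 0 < M i) → (∀ i, |a i| ≤ 2⁻¹ * M i) →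
      (∀ i, 0 < u i 0 ∧ ‖E4.spatial (u i)‖ ≤ 2⁻¹ * u i 0) →
      (∀ i j, i ≠ j → 40 * (M i + M j) ≤ dist (p i) (p j) ∧
        0 < ⟪p i - p j, (u i 0)⁻¹ • E4.spatial (u i) - (u j 0)⁻¹ • E4.spatial (u j)⟫_ℝ) →
      ∀ (G : E4 → Fin 4 → Fin 4 → ℝ),
      (∀ x μ ν, G x μ ν = Minkowski.bilin (E4.basisVector μ) (E4.basisVector ν) -
        ∑ i, Real.smoothTransition (2 - Kerr.radius (a i) (q i x) / (8 * M i)) *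
          (2 * Kerr.scalarH (M i) (a i) (q i x)) *
          ((Λ i : E4 ≃L[ℝ] E4) (Kerr.nullVector (a i) (q i x))) μ *
          ((Λ i : E4 ≃L[ℝ] E4) (Kerr.nullVector (a i) (q i x))) ν) →
      ∀ ψ : E4 → ℝ, ContDiff ℝ ∞ ψ →
        (∀ x : E4, 0 ≤ x 0 → (∀ i, Kerr.rPlus (M i) (a i) < Kerr.radius (a i) (q i x)) →
          ∑ μ : Fin 4, fderiv ℝ (fun y ↦ ∑ ν : Fin 4, G y μ ν * fderiv ℝ ψ y (E4.basisVector ν)) x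
            (E4.basisVector μ) = 0) →
        ∀ (i : Fin N) (z : E4),
          0 ≤ ((Λ i : E4 ≃L[ℝ] E4) z + E4.ofTimeSpace 0 (p i)) 0 →
          Kerr.rPlus (M i) (a i) < Kerr.radius (a i) z → Kerr.radius (a i) z < 8 * M i →
          KerrSchild.waveOperator
            (KerrSchild.inverseMetric (fun y ↦ 2 * Kerr.scalarH (M i) (a i) y) (Kerr.nullVector (a i)))
            (fun w ↦ ψ ((Λ i : E4 ≃L[ℝ] E4) w + E4.ofTimeSpace 0 (p i))) z = 0 := by
  intro N M a Λ p u q hu hq hM ha hv hsep G hG ψ hψ hsol i z hz0 hzr hz8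
  -- `qᵢ ∘ Pᵢ = id`
  have hqP : ∀ w, q i ((Λ i : E4 ≃L[ℝ] E4) w + E4.ofTimeSpace 0 (p i)) = w := fun w ↦ by
    rw [hq, poincareInv, add_sub_cancel_right, ContinuousLinearEquiv.symm_apply_apply]
  have hzpos : 0 < Kerr.radius (a i) z := Theorems.radius_pos_of_rPlus_lt (hM i) hzr
  -- the own (untruncated) boosted field of hole `i`
  obtain ⟨Gi, hGi⟩ : ∃ Gi : E4 → Fin 4 → Fin 4 → ℝ, ∀ y α β, Gi y α β =
      Minkowski.bilin (E4.basisVector α) (E4.basisVector β) -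
        2 * Kerr.scalarH (M i) (a i) (q i y) *
          ((Λ i : E4 ≃L[ℝ] E4) (Kerr.nullVector (a i) (q i y))) α *
          ((Λ i : E4 ≃L[ℝ] E4) (Kerr.nullVector (a i) (q i y))) β := ⟨_, fun _ _ _ ↦ rfl⟩
  -- (a) the lab point `x = Pᵢ z` lies outside all horizons, so `□_G ψ (x) = 0`
  set x : E4 := (Λ i : E4 ≃L[ℝ] E4) z + E4.ofTimeSpace 0 (p i) with hx
  have hqx : q i x = z := hqP z
  have h17 : Kerr.radius (a i) (q i x) ≤ 17 * M i := by
    rw [hqx]; have := hM i; linarith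
  have hout : ∀ j, Kerr.rPlus (M j) (a j) < Kerr.radius (a j) (q j x) := by
    intro j
    by_cases hji : j = i
    · rw [hji, hqx]; exact hzr
    · have hdis := stub_zoneDisjoint M a Λ p u q hu hq hM ha hv hsep x hz0 i j (Ne.symm hji) h17
      have h2 := Kerr.rPlus_le_two_mul_self (hM j).le (a j)
      have := hM j
      linarith
  have hsolx : KerrSchild.waveOperator G ψ x = 0 := hsol x hz0 hout
  -- near `x` the patched field is the own field of hole `i` (openness of the radius conditions)
  have hnear : ∀ᶠ y in 𝓝 x, ∀ j, j ≠ i → 16 * M j < Kerr.radius (a j) (q j y) := by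
    refine Filter.eventually_all.2 fun j ↦ ?_
    by_cases hji : j = i
    · exact Filter.Eventually.of_forall fun y h ↦ absurd hji h
    · have h17j : 17 * M j < Kerr.radius (a j) (q j x) :=
        stub_zoneDisjoint M a Λ p u q hu hq hM ha hv hsep x hz0 i j (Ne.symm hji) h17
      have h16 : 16 * M j < Kerr.radius (a j) (q j x) := by have := hM j; linarith
      have hcont : Continuous fun y ↦ Kerr.radius (a j) (q j y) := by
        have hqj : q j = poincareInv (Λ j) (E4.ofTimeSpace 0 (p j)) := funext (hq j)
        rw [hqj]
        exact (Kerr.continuous_radius (a j)).comp (continuous_poincareInv _ _)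
      exact (continuousAt_const.eventually_lt hcont.continuousAt h16).mono fun y hy _ ↦ hy
  have hnear_i : ∀ᶠ y in 𝓝 x, Kerr.radius (a i) (q i y) < 8 * M i := by
    have hcont : Continuous fun y ↦ Kerr.radius (a i) (q i y) := by
      have hqi : q i = poincareInv (Λ i) (E4.ofTimeSpace 0 (p i)) := funext (hq i)
      rw [hqi]
      exact (Kerr.continuous_radius (a i)).comp (continuous_poincareInv _ _)
    have h8 : Kerr.radius (a i) (q i x) < 8 * M i := by rwa [hqx]
    exact hcont.continuousAt.eventually_lt continuousAt_const h8
  have hGev : ∀ α β : Fin 4, (fun y ↦ G y α β) =ᶠ[𝓝 x] fun y ↦ Gi y α β := by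
    intro α β
    filter_upwards [hnear, hnear_i] with y hy hyi
    rw [hG, hGi, Finset.sum_eq_single i (fun j _ hji ↦ ?_) fun h ↦ absurd (Finset.mem_univ i) h]
    · rw [Theorems.cruxCutoff_eq_one (hM i) hyi.le]
      ring
    · rw [Theorems.cruxCutoff_eq_zero (hM j) (hy j hji).le]
      ring
  have hGi0 : KerrSchild.waveOperator Gi ψ x = 0 := by
    rw [← KerrSchild.waveOperator_congr_of_eventuallyEq hGev ψ]
    exact hsolx
  -- (b) covariance under `Pᵢ`: the fluxes `Σ_β Gᵢ^{αβ} ∂_β ψ` are smooth at the exterior point `x`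
  have hdψ : ∀ β, ContDiff ℝ ∞ fun y ↦ fderiv ℝ ψ y (E4.basisVector β) := fun β ↦
    (contDiff_infty_iff_fderiv.1 hψ).2.clm_apply contDiff_const
  have hV : ∀ α, DifferentiableAt ℝ
      (fun y ↦ ∑ β, Gi y α β * fderiv ℝ ψ y (E4.basisVector β)) x := by
    intro α
    have hxpos : 0 < Kerr.radius (a i) (poincareInv (Λ i) (E4.ofTimeSpace 0 (p i)) x) := by
      rw [← hq, hqx]; exact hzpos
    refine DifferentiableAt.fun_sum fun β _ ↦ DifferentiableAt.fun_mul ?_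
      ((hdψ β).differentiable (by simp) x)
    have hfun : (fun y ↦ Gi y α β) = fun y ↦
        Minkowski.bilin (E4.basisVector α) (E4.basisVector β) -
          2 * Kerr.scalarH (M i) (a i) (poincareInv (Λ i) (E4.ofTimeSpace 0 (p i)) y) *
            ((Λ i : E4 ≃L[ℝ] E4) (Kerr.nullVector (a i)
              (poincareInv (Λ i) (E4.ofTimeSpace 0 (p i)) y))) α *
            ((Λ i : E4 ≃L[ℝ] E4) (Kerr.nullVector (a i)
              (poincareInv (Λ i) (E4.ofTimeSpace 0 (p i)) y))) β := by
      funext y; rw [hGi, hq]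
    rw [hfun]
    exact (contDiffAt_ownField (M i) (a i) (Λ i) _ hxpos α β).differentiableAt (by simp)
  have hcov := waveOperator_comp_affine (Λ i : E4 ≃L[ℝ] E4) (E4.ofTimeSpace 0 (p i)) Gi ψ z hV
  -- (c) the pulled-back coefficients are the exact Kerr ones
  have hK : (fun w μ ν ↦ ∑ α, ∑ β, ((Λ i : E4 ≃L[ℝ] E4).symm (E4.basisVector α)) μ *
      ((Λ i : E4 ≃L[ℝ] E4).symm (E4.basisVector β)) ν *
      Gi ((Λ i : E4 ≃L[ℝ] E4) w + E4.ofTimeSpace 0 (p i)) α β) =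
      KerrSchild.inverseMetric (fun y ↦ 2 * Kerr.scalarH (M i) (a i) y) (Kerr.nullVector (a i)) := by
    funext w μ ν
    simp only [hGi, hqP, KerrSchild.inverseMetric]
    exact pullback_boostedKerrSchild (Λ i) _ _ μ ν
  rw [hK] at hcov
  rw [hcov]
  exact hGi0

end Summit.FinalStateConjecture.FinalStateConjecture.Cruxes.AdiabaticMultiKerrILED.Sketch

end
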